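import Summits.Ventures.PercRepro.S1SevenSixSeparators

/-!
# PercRepro — TWO SHAPES OF THE `(8, 6)` CELL WITH A LINE AS A PART: `U_{2,5} ⊕ (rank 6 on 9)` AND
`(rank 6 on 8) ⊕ U_{2,6}` (p2, gen 28; SUBCLAIM-S1 §6.10 (xvii)(p); PARTIAL — towards the `(8, 6)` capstone)

Φ(8, 4) = 76/15.
* `U_{2,5} ⊕ N` with `N` of rank `6` on `9` points (nullities `3 + 3`): `#U ≤ 20 N_N(6, 2) + 5 N_N(6, 3)`, Theorem N
  at `(6, 2)` and Theorem M at `(6, 3)` on `N`: `Φ · #U ≤ 15.6 (f_N(3) + f_N(4) + f_N(5)) + 8.44 (f_N(4) + f_N(5))`;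
  `#Y ≥ 26 (f_N(3) + f_N(4) + f_N(5)) + 5 (f_N(4) + f_N(5))`. No coloop hypothesis on `N`.
* `N ⊕ U_{2,6}` with `N` of rank `6` on `8` points (nullities `2 + 4`): `#U ≤ 50 N_N(6, 2)`, Theorem N at `(6, 2)`:
  `Φ · #U ≤ 39 (…) ≤ 57 (…) ≤ #Y`.
Nothing is claimed about any cell.

* `c025_eight_four_disjointSum_line_five_rank_six_nine`, `c025_eight_four_disjointSum_rank_six_eight_line_six`.
Axioms: standard.
-/

open scoped Matroid

namespace PercRepro

namespace S1

open Set

variable {α : Type}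

/-- The arithmetic of `U_{2,5} ⊕ (rank 6 on 9)` at `(8, 4)`. -/
theorem consumer_arith_line_five_rank_six_nine {u y P2 P3 f3 f4 f5 : ℚ} (hU : u ≤ 20 * P2 + 5 * P3)
    (h62 : 13 / 2 * P2 ≤ f3 + f4 + f5) (h63 : 3 * P3 ≤ f4 + f5) (hY : 26 * (f3 + f4 + f5) + 5 * (f4 + f5) ≤ y)
    (hf3 : 0 ≤ f3) (hf4 : 0 ≤ f4) (hf5 : 0 ≤ f5) : 76 / 15 * u ≤ y := by
  linarith

/-- **`U_{2,5} ⊕ N` at `(8, 4)`**, `N` of rank `6` on `9` points (any finite `N`; `M` of rank `2` on `5` points with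
all pairs of rank `2`). -/
theorem c025_eight_four_disjointSum_line_five_rank_six_nine (M N : Matroid α) [M.Finite] [N.Finite]
    (h : Disjoint M.E N.E) (hM : M.eRank = ((2 : ℕ) : ℕ∞)) (hME : M.E.ncard = 5)
    (hpairs : ∀ e ∈ M.E, ∀ f ∈ M.E, e ≠ f → M.eRk {e, f} = 2) (hN : N.eRank = ((6 : ℕ) : ℕ∞))
    (hNE : N.E.ncard = 9) :
    phiK 8 4 * ({A : Set α | A ⊆ (M.disjointSum N h).E ∧ (M.disjointSum N h).eRk A = ((8 : ℕ) : ℕ∞) ∧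
        (M.disjointSum N h).eRk ((M.disjointSum N h).E \ A) = ((4 : ℕ) : ℕ∞)}.ncard : ℚ) ≤
      ({A : Set α | A ⊆ (M.disjointSum N h).E ∧ ((4 : ℕ) : ℕ∞) < (M.disjointSum N h).eRk A ∧
        (M.disjointSum N h).eRk A < ((8 : ℕ) : ℕ∞)}.ncard : ℚ) := by
  have hU : {A : Set α | A ⊆ (M.disjointSum N h).E ∧ (M.disjointSum N h).eRk A = ((8 : ℕ) : ℕ∞) ∧
      (M.disjointSum N h).eRk ((M.disjointSum N h).E \ A) = ((4 : ℕ) : ℕ∞)}.ncard ≤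
      20 * (profileSet N 6 2).ncard + 5 * (profileSet N 6 3).ncard := by
    rw [disjointSum_ncard_U_eq_finsum M N h 8 4, finsum_mem_coe_finset]
    rw [Finset.sum_eq_add_of_mem (2, 2) (2, 1) (by decide) (by decide) (by decide) ?_]
    · dsimp only
      show (profileSet M 2 2).ncard * (profileSet N 6 2).ncard + (profileSet M 2 1).ncard * (profileSet N 6 3).ncard ≤ _
      have h22 := ncard_profileSet_two_two_le_five M hME
      have h21 := ncard_profileSet_top_one_le_of_pairs' hpairs 2
      rw [hME] at h21
      exact Nat.add_le_add (Nat.mul_le_mul_right _ h22) (Nat.mul_le_mul_right _ h21)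
    · rintro ⟨a, b⟩ hmem ⟨hne1, hne2⟩
      rw [Finset.mem_product, Finset.mem_range, Finset.mem_range] at hmem
      dsimp only
      rcases Nat.lt_or_ge 2 a with ha | ha
      · rw [profileSet_eq_empty_of_eRank_lt M hM ha b, ncard_empty, zero_mul]
      rcases Nat.lt_or_ge a 2 with ha' | ha'
      · have h7a : 6 < 8 - a := by omega
        rw [profileSet_eq_empty_of_eRank_lt N hN h7a (4 - b), ncard_empty, mul_zero]
      have ha2 : a = 2 := by omega
      subst ha2
      rw [show (8 : ℕ) - 2 = 6 from rfl]
      rcases Nat.lt_or_ge b 1 with hb | hb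
      · -- `b = 0`: `N_N(5, 4) = ∅` on `8` points
        have hb0 : b = 0 := by omega
        subst hb0
        rw [profileSet_eq_empty_of_ncard_lt N (by rw [hNE]; norm_num : N.E.ncard < 6 + (4 - 0)), ncard_empty,
          mul_zero]
      · have hb3 : 2 < b := by
          rcases Nat.lt_or_ge b 3 with hb3 | hb3
          · exfalso
            rcases Nat.lt_or_ge b 2 with hb2 | hb2
            · exact hne2 (by congr 1; omega)
            · exact hne1 (by congr 1; omega)
          · omega
        rw [profileSet_eq_empty_of_eRank_lt_snd M hM hb3 2, ncard_empty, zero_mul]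
  have hY : 26 * ((rankSet N 3).ncard + (rankSet N 4).ncard + (rankSet N 5).ncard) +
      5 * ((rankSet N 4).ncard + (rankSet N 5).ncard) ≤
      {A : Set α | A ⊆ (M.disjointSum N h).E ∧ ((4 : ℕ) : ℕ∞) < (M.disjointSum N h).eRk A ∧
        (M.disjointSum N h).eRk A < ((8 : ℕ) : ℕ∞)}.ncard := by
    rw [disjointSum_ncard_Y_eq_finsum M N h 8 4, finsum_mem_coe_finset]
    have hsub : ({(1, 4), (1, 5), (2, 3), (2, 4), (2, 5)} : Finset (ℕ × ℕ)) ⊆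
        (Finset.range 8 ×ˢ Finset.range 8).filter (fun x : ℕ × ℕ => 4 < x.1 + x.2 ∧ x.1 + x.2 < 8) := by
      decide
    refine le_trans ?_ (Finset.sum_le_sum_of_subset hsub)
    rw [Finset.sum_insert (by decide), Finset.sum_insert (by decide), Finset.sum_insert (by decide),
      Finset.sum_insert (by decide), Finset.sum_singleton]
    dsimp only
    have f2 : 26 ≤ (rankSet M 2).ncard := by
      have := ncard_rankSet_two_ge_of_rank_two M hM hpairs
      rwa [hME, show 2 ^ 5 - 1 - 5 = 26 by decide] at this
    have f1 : 5 ≤ (rankSet M 1).ncard := by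
      have := ncard_le_ncard_rankSet_one_of_pairs hpairs (by omega)
      rwa [hME] at this
    have e14 := Nat.mul_le_mul_right (rankSet N 4).ncard f1
    have e15 := Nat.mul_le_mul_right (rankSet N 5).ncard f1
    have e23 := Nat.mul_le_mul_right (rankSet N 3).ncard f2
    have e24 := Nat.mul_le_mul_right (rankSet N 4).ncard f2
    have e25 := Nat.mul_le_mul_right (rankSet N 5).ncard f2
    linarith
  have h62 : (13 / 2 : ℚ) * ((profileSet N 6 2).ncard : ℚ) ≤
      ((rankSet N 3).ncard : ℚ) + ((rankSet N 4).ncard : ℚ) + ((rankSet N 5).ncard : ℚ) := by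
    have h0 := ThmN.c025_two_all N 6 (by norm_num)
    unfold ThmN.RLS at h0
    rw [phiK_six_two,
      ySet_eq_rankSet_union3_of_eq N (q := 2) (p := 6) (k := 3) (k' := 4) (k'' := 5) rfl rfl rfl rfl,
      ncard_union_eq (Set.disjoint_union_left.mpr
        ⟨rankSet_disjoint_of_ne N (by norm_num), rankSet_disjoint_of_ne N (by norm_num)⟩)
        ((rankSet_finite N 3).union (rankSet_finite N 4)) (rankSet_finite N 5),
      ncard_union_eq (rankSet_disjoint_of_ne N (by norm_num)) (rankSet_finite N 3) (rankSet_finite N 4)] at h0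
    push_cast at h0
    exact h0
  have h63 : (3 : ℚ) * ((profileSet N 6 3).ncard : ℚ) ≤ ((rankSet N 4).ncard : ℚ) + ((rankSet N 5).ncard : ℚ) := by
    have h0 := SevenThree.c025_three_all N 6 (by norm_num)
    unfold ThmN.RLS at h0
    rw [phiK_six_three, ySet_eq_rankSet_union_of_eq N (q := 3) (p := 6) (k := 4) (k' := 5) rfl rfl rfl,
      ncard_union_eq (rankSet_disjoint_of_ne N (by norm_num)) (rankSet_finite N 4) (rankSet_finite N 5)] at h0
    push_cast at h0
    exact h0
  rw [phiK_eight_four]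
  have hU' : (({A : Set α | A ⊆ (M.disjointSum N h).E ∧ (M.disjointSum N h).eRk A = ((8 : ℕ) : ℕ∞) ∧
      (M.disjointSum N h).eRk ((M.disjointSum N h).E \ A) = ((4 : ℕ) : ℕ∞)}.ncard : ℕ) : ℚ) ≤
      20 * ((profileSet N 6 2).ncard : ℚ) + 5 * ((profileSet N 6 3).ncard : ℚ) := by
    exact_mod_cast hU
  have hY' : 26 * (((rankSet N 3).ncard : ℚ) + ((rankSet N 4).ncard : ℚ) + ((rankSet N 5).ncard : ℚ)) +
      5 * (((rankSet N 4).ncard : ℚ) + ((rankSet N 5).ncard : ℚ)) ≤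
      (({A : Set α | A ⊆ (M.disjointSum N h).E ∧ ((4 : ℕ) : ℕ∞) < (M.disjointSum N h).eRk A ∧
        (M.disjointSum N h).eRk A < ((8 : ℕ) : ℕ∞)}.ncard : ℕ) : ℚ) := by
    exact_mod_cast hY
  exact consumer_arith_line_five_rank_six_nine hU' h62 h63 hY' (Nat.cast_nonneg _) (Nat.cast_nonneg _)
    (Nat.cast_nonneg _)

/-- The arithmetic of `(rank 6 on 8) ⊕ U_{2,6}` at `(8, 4)`. -/
theorem consumer_arith_rank_six_eight_line_six {u y P T : ℚ} (hU : u ≤ 50 * P) (h62 : 13 / 2 * P ≤ T)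
    (hY : 57 * T ≤ y) (hT : 0 ≤ T) : 76 / 15 * u ≤ y := by
  linarith

/-- **`M ⊕ U_{2,6}` at `(8, 4)`**, `M` of rank `6` on `8` points (any finite `M`), `N` of rank `2` on `6` points with
all pairs of rank `2`. -/
theorem c025_eight_four_disjointSum_rank_six_eight_line_six (M N : Matroid α) [M.Finite] [N.Finite]
    (h : Disjoint M.E N.E) (hM : M.eRank = ((6 : ℕ) : ℕ∞)) (hME : M.E.ncard = 8) (hN : N.eRank = ((2 : ℕ) : ℕ∞))
    (hNE : N.E.ncard = 6) (hpairs : ∀ e ∈ N.E, ∀ f ∈ N.E, e ≠ f → N.eRk {e, f} = 2) :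
    phiK 8 4 * ({A : Set α | A ⊆ (M.disjointSum N h).E ∧ (M.disjointSum N h).eRk A = ((8 : ℕ) : ℕ∞) ∧
        (M.disjointSum N h).eRk ((M.disjointSum N h).E \ A) = ((4 : ℕ) : ℕ∞)}.ncard : ℚ) ≤
      ({A : Set α | A ⊆ (M.disjointSum N h).E ∧ ((4 : ℕ) : ℕ∞) < (M.disjointSum N h).eRk A ∧
        (M.disjointSum N h).eRk A < ((8 : ℕ) : ℕ∞)}.ncard : ℚ) := by
  have hU : {A : Set α | A ⊆ (M.disjointSum N h).E ∧ (M.disjointSum N h).eRk A = ((8 : ℕ) : ℕ∞) ∧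
      (M.disjointSum N h).eRk ((M.disjointSum N h).E \ A) = ((4 : ℕ) : ℕ∞)}.ncard ≤
      50 * (profileSet M 6 2).ncard := by
    rw [disjointSum_ncard_U_eq_finsum M N h 8 4, finsum_mem_coe_finset]
    rw [Finset.sum_eq_single_of_mem (6, 2) (by decide) ?_]
    · dsimp only
      show (profileSet M 6 2).ncard * (profileSet N 2 2).ncard ≤ _
      have h22 := ncard_profileSet_two_two_le_six N hNE
      calc (profileSet M 6 2).ncard * (profileSet N 2 2).ncard ≤ (profileSet M 6 2).ncard * 50 :=
            Nat.mul_le_mul_left _ h22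
        _ = 50 * (profileSet M 6 2).ncard := by ring
    · rintro ⟨a, b⟩ hmem hne
      rw [Finset.mem_product, Finset.mem_range, Finset.mem_range] at hmem
      dsimp only
      rcases Nat.lt_or_ge 6 a with ha | ha
      · rw [profileSet_eq_empty_of_eRank_lt M hM ha b, ncard_empty, zero_mul]
      rcases Nat.lt_or_ge a 6 with ha' | ha'
      · have h7a : 2 < 8 - a := by omega
        rw [profileSet_eq_empty_of_eRank_lt N hN h7a (4 - b), ncard_empty, mul_zero]
      have ha6 : a = 6 := by omega
      subst ha6
      rw [show (8 : ℕ) - 6 = 2 from rfl]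
      rcases Nat.lt_or_ge b 2 with hb | hb
      · -- `N_N(2, 4 − b) = ∅`: a complement of rank `≥ 3` in a matroid of rank `2`
        rw [profileSet_eq_empty_of_eRank_lt_snd N hN (by omega) 2, ncard_empty, mul_zero]
      · have hb3 : 2 < b := by
          rcases Nat.lt_or_ge b 3 with hb3 | hb3
          · exfalso; exact hne (by congr 1; omega)
          · omega
        -- `N_M(5, b) = ∅` for `b ≥ 3` on `7` points: the complement would need `≥ 3` points beside `5`
        have h7 : M.E.ncard < 6 + b := by rw [hME]; omega
        rw [profileSet_eq_empty_of_ncard_lt M h7, ncard_empty, zero_mul]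
  have hY : 57 * ((rankSet M 3).ncard + (rankSet M 4).ncard + (rankSet M 5).ncard) ≤
      {A : Set α | A ⊆ (M.disjointSum N h).E ∧ ((4 : ℕ) : ℕ∞) < (M.disjointSum N h).eRk A ∧
        (M.disjointSum N h).eRk A < ((8 : ℕ) : ℕ∞)}.ncard := by
    rw [disjointSum_ncard_Y_eq_finsum M N h 8 4, finsum_mem_coe_finset]
    have hsub : ({(3, 2), (4, 2), (5, 2)} : Finset (ℕ × ℕ)) ⊆
        (Finset.range 8 ×ˢ Finset.range 8).filter (fun x : ℕ × ℕ => 4 < x.1 + x.2 ∧ x.1 + x.2 < 8) := by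
      decide
    refine le_trans ?_ (Finset.sum_le_sum_of_subset hsub)
    rw [Finset.sum_insert (by decide), Finset.sum_insert (by decide), Finset.sum_singleton]
    dsimp only
    have g2 : 57 ≤ (rankSet N 2).ncard := by
      have := ncard_rankSet_two_ge_of_rank_two N hN hpairs
      rwa [hNE, show 2 ^ 6 - 1 - 6 = 57 by decide] at this
    have e32 := Nat.mul_le_mul_left (rankSet M 3).ncard g2
    have e42 := Nat.mul_le_mul_left (rankSet M 4).ncard g2
    have e52 := Nat.mul_le_mul_left (rankSet M 5).ncard g2
    linarith
  have h62 : (13 / 2 : ℚ) * ((profileSet M 6 2).ncard : ℚ) ≤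
      ((rankSet M 3).ncard : ℚ) + ((rankSet M 4).ncard : ℚ) + ((rankSet M 5).ncard : ℚ) := by
    have h0 := ThmN.c025_two_all M 6 (by norm_num)
    unfold ThmN.RLS at h0
    rw [phiK_six_two,
      ySet_eq_rankSet_union3_of_eq M (q := 2) (p := 6) (k := 3) (k' := 4) (k'' := 5) rfl rfl rfl rfl,
      ncard_union_eq (Set.disjoint_union_left.mpr
        ⟨rankSet_disjoint_of_ne M (by norm_num), rankSet_disjoint_of_ne M (by norm_num)⟩)
        ((rankSet_finite M 3).union (rankSet_finite M 4)) (rankSet_finite M 5),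
      ncard_union_eq (rankSet_disjoint_of_ne M (by norm_num)) (rankSet_finite M 3) (rankSet_finite M 4)] at h0
    push_cast at h0
    exact h0
  rw [phiK_eight_four]
  have hU' : (({A : Set α | A ⊆ (M.disjointSum N h).E ∧ (M.disjointSum N h).eRk A = ((8 : ℕ) : ℕ∞) ∧
      (M.disjointSum N h).eRk ((M.disjointSum N h).E \ A) = ((4 : ℕ) : ℕ∞)}.ncard : ℕ) : ℚ) ≤
      50 * ((profileSet M 6 2).ncard : ℚ) := by
    exact_mod_cast hU
  have hY' : 57 * (((rankSet M 3).ncard : ℚ) + ((rankSet M 4).ncard : ℚ) + ((rankSet M 5).ncard : ℚ)) ≤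
      (({A : Set α | A ⊆ (M.disjointSum N h).E ∧ ((4 : ℕ) : ℕ∞) < (M.disjointSum N h).eRk A ∧
        (M.disjointSum N h).eRk A < ((8 : ℕ) : ℕ∞)}.ncard : ℕ) : ℚ) := by
    exact_mod_cast hY
  have hT : (0 : ℚ) ≤ ((rankSet M 3).ncard : ℚ) + ((rankSet M 4).ncard : ℚ) + ((rankSet M 5).ncard : ℚ) := by
    positivity
  exact consumer_arith_rank_six_eight_line_six hU' h62 hY' hT

end S1

end PercRepro
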